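import Summits.ValiantsHypothesis.ValiantsHypothesis.Theorems.GrenetZeonDualUnipotentThreeHalvesHeavyTopBorderShift

/-!
# `GrenetZeon.DualUnipotentThreeHalves` (stmt-ValiantsHypothesis-24318) — P-Q1 kernel port (lead-g2 `Q1-PROOF.md` §0, `P-Q1-LEVEL2-PORTMAP.md` L2.1):
# THE SHIFT SANDWICH `(A^a M A^b)_{ij} = M_{i+a, j−b}`, TRACES AGAINST MATRIX UNITS, AND THE ENVELOPE `T` READ OFF THE FIRST-ORDER IDENTITY

Experiment cell «val-heavytop-census» (D-0160), engine seat val-htc-eng-1 (g3), kit 0; director R340 (3) (P-Q1 port, eng lineage).  Conventions of the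
Level-1 bricks (ambient `Fin (s+1)`, border `ω = Fin.last s`, shift `A` through `hA : A i j = if j = i+1 ∧ j < s then 1 else 0`; ✓ `…HeavyTopBorderShift`).

§1 THE WORKHORSE (lead-g2 port map L2.1 «state once»):
* `shift_pow_mul_apply` — block row `i < s`: `(A^a M)_{ij} = M_{i+a,j}` if `i + a < s` else `0` (all `a`); `shift_pow_succ_mul_apply_last` — `(A^{a+1} M)_{ωj} = 0`;
* `mul_shift_pow_apply` — block column `j < s`: `(M A^b)_{ij} = M_{i,j−b}` if `b ≤ j` else `0` (all `b`, any row); `mul_shift_pow_succ_apply_last` — `(M A^{b+1})_{iω} = 0`;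
* ★ `shift_sandwich_apply` — block `i, j < s`: `(A^a M A^b)_{ij} = M_{i+a, j−b}` if `i + a < s ∧ b ≤ j`, else `0`.
§2 `trace_vecMulVec_mul` (`tr(x yᵀ N) = yᵀ N x`), `trace_single_mul` (`tr(E_{pq} N) = N_{qp}`, `E_{pq} = vecMulVec (Pi.single p 1) (Pi.single q 1)`).
§3 THE ENVELOPE `T` OF Q1-PROOF §0, from `L(B) := Σ_{i<s} A^i B A^{s−1−i} = 0` (✓ p688831 `firstOrder_eq_zero_of_mem` at the shift, nilindex `≤ s`):
* `firstOrder_term_apply` — block entries of one sandwich term;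
* ★ `apply_last_zero_eq_zero_of_firstOrder` — `B_{ω,0} = 0` (lead: `L(B)_{s,s−1} = B_{s,1}`); ★ `apply_pred_last_eq_zero_of_firstOrder` — `B_{s−1,ω} = 0`
  (lead: `L(B)_{1,s} = B_{s−1,s}`); ★ `subdiag_sum_eq_zero_of_firstOrder` — for every `h < s` the `h`-th block subdiagonal sum `Σ_c B_{c+h,c}` vanishes
  (lead: `L(B)_{p,r} = Σ_a B_{a+h,a}`, read at `(0, s−1−h)`); `apply_last_last_eq_zero_of_firstOrder` — with `tr B = 0`, `B_{ωω} = 0`.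
  Together: `V ⊂ T = {B : all block subdiagonal sums 0, B_{ω,0} = B_{s−1,ω} = B_{ωω} = 0}` (codim `s + 3` in `M_{s+1}`), the graded ambient space of
  Level 1 (`V⁺ ⊂ ⟨E_{iω} : i ≤ s−2⟩`, `V⁻ ⊂ ⟨E_{ωj} : j ≥ 1⟩`, `V⁰ ⊂ M_s ⊕ 0`) and of the Level-2 chart (`𝒞₀` = trace-free diagonal / subdiagonal combinations).

Pure matrix algebra; nothing here is a statement about nilpotent subspaces, ι(7), (5,7), R2 or 24318 (OPEN / not moved); VP ≠ VNP NOT proved.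
`--supports stmt-ValiantsHypothesis-24318 --as helper`.  No definitions, no named facts.
[lead-g2 `Q1-PROOF.md` §0, `P-Q1-LEVEL2-PORTMAP.md` (B)/(C) L2.1 = crux `CENSUS-P-Q1-LEVEL2-PORTMAP.md`; this seat]
-/

set_option linter.dupNamespace false
set_option autoImplicit false

namespace Summit.ValiantsHypothesis.ValiantsHypothesis.Theorems.GrenetZeon.HeavyTopShiftSandwich

open Matrix
open scoped BigOperators
open Summit.ValiantsHypothesis.ValiantsHypothesis.Theorems.GrenetZeon.HeavyTopBorderShift (shift_pow_succ_apply)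

variable {s : ℕ}

/-! ## §1 The shift sandwich (L2.1 of the Level-2 port map) -/

/-- **Left shift**: for a block row `i < s`, `(A^a M)_{ij} = M_{i+a, j}` if `i + a < s`, else `0` (any `a`, `a = 0` included). [folklore] -/
theorem shift_pow_mul_apply (A : Matrix (Fin (s + 1)) (Fin (s + 1)) ℂ)
    (hA : ∀ i j : Fin (s + 1), A i j = if (j : ℕ) = i + 1 ∧ (j : ℕ) < s then 1 else 0) (M : Matrix (Fin (s + 1)) (Fin (s + 1)) ℂ)
    (a : ℕ) (i j : Fin (s + 1)) (hi : (i : ℕ) < s) :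
    (A ^ a * M) i j = if h : (i : ℕ) + a < s then M ⟨(i : ℕ) + a, by omega⟩ j else 0 := by
  rcases Nat.eq_zero_or_pos a with rfl | ha
  · rw [pow_zero, Matrix.one_mul, dif_pos (by omega)]
    exact congrArg (M · j) (Fin.ext rfl)
  · obtain ⟨a', rfl⟩ : ∃ a', a = a' + 1 := ⟨a - 1, by omega⟩
    rw [Matrix.mul_apply]
    by_cases h : (i : ℕ) + (a' + 1) < s
    · rw [dif_pos h, Finset.sum_eq_single ⟨(i : ℕ) + (a' + 1), by omega⟩]
      · rw [shift_pow_succ_apply A hA a', if_pos (by simp; omega), one_mul]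
      · intro k _ hk
        have hne : (k : ℕ) ≠ i + (a' + 1) := fun e => hk (Fin.ext e)
        rw [shift_pow_succ_apply A hA a', if_neg (by omega), zero_mul]
      · intro h'
        exact absurd (Finset.mem_univ _) h'
    · rw [dif_neg h]
      refine Finset.sum_eq_zero fun k _ => ?_
      rw [shift_pow_succ_apply A hA a', if_neg (by omega), zero_mul]

/-- **Left shift kills the border row**: `(A^{a+1} M)_{ω j} = 0`. [folklore] -/
theorem shift_pow_succ_mul_apply_last (A : Matrix (Fin (s + 1)) (Fin (s + 1)) ℂ)
    (hA : ∀ i j : Fin (s + 1), A i j = if (j : ℕ) = i + 1 ∧ (j : ℕ) < s then 1 else 0) (M : Matrix (Fin (s + 1)) (Fin (s + 1)) ℂ)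
    (a : ℕ) (j : Fin (s + 1)) : (A ^ (a + 1) * M) (Fin.last s) j = 0 := by
  rw [Matrix.mul_apply]
  refine Finset.sum_eq_zero fun k _ => ?_
  rw [shift_pow_succ_apply A hA a, if_neg (by simp; omega), zero_mul]

/-- **Right shift**: for a block column `j < s`, `(M A^b)_{ij} = M_{i, j−b}` if `b ≤ j`, else `0` (any `b`, any row `i`). [folklore] -/
theorem mul_shift_pow_apply (A : Matrix (Fin (s + 1)) (Fin (s + 1)) ℂ)
    (hA : ∀ i j : Fin (s + 1), A i j = if (j : ℕ) = i + 1 ∧ (j : ℕ) < s then 1 else 0) (M : Matrix (Fin (s + 1)) (Fin (s + 1)) ℂ)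
    (b : ℕ) (i j : Fin (s + 1)) (hj : (j : ℕ) < s) :
    (M * A ^ b) i j = if h : b ≤ (j : ℕ) then M i ⟨(j : ℕ) - b, by omega⟩ else 0 := by
  rcases Nat.eq_zero_or_pos b with rfl | hb
  · rw [pow_zero, Matrix.mul_one, dif_pos (Nat.zero_le _)]
    simp
  · obtain ⟨b', rfl⟩ : ∃ b', b = b' + 1 := ⟨b - 1, by omega⟩
    rw [Matrix.mul_apply]
    by_cases h : b' + 1 ≤ (j : ℕ)
    · rw [dif_pos h, Finset.sum_eq_single ⟨(j : ℕ) - (b' + 1), by omega⟩]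
      · rw [shift_pow_succ_apply A hA b', if_pos (by simp; omega), mul_one]
      · intro k _ hk
        have hne : (k : ℕ) ≠ j - (b' + 1) := fun e => hk (Fin.ext e)
        rw [shift_pow_succ_apply A hA b', if_neg (by omega), mul_zero]
      · intro h'
        exact absurd (Finset.mem_univ _) h'
    · rw [dif_neg h]
      refine Finset.sum_eq_zero fun k _ => ?_
      rw [shift_pow_succ_apply A hA b', if_neg (by omega), mul_zero]

/-- **Right shift kills the border column**: `(M A^{b+1})_{i ω} = 0`. [folklore] -/
theorem mul_shift_pow_succ_apply_last (A : Matrix (Fin (s + 1)) (Fin (s + 1)) ℂ)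
    (hA : ∀ i j : Fin (s + 1), A i j = if (j : ℕ) = i + 1 ∧ (j : ℕ) < s then 1 else 0) (M : Matrix (Fin (s + 1)) (Fin (s + 1)) ℂ)
    (b : ℕ) (i : Fin (s + 1)) : (M * A ^ (b + 1)) i (Fin.last s) = 0 := by
  rw [Matrix.mul_apply]
  refine Finset.sum_eq_zero fun k _ => ?_
  rw [shift_pow_succ_apply A hA b, if_neg (by simp), mul_zero]

/-- ★ **THE SHIFT SANDWICH** (workhorse of the Level-2 port map, L2.1): for block indices `i, j < s` and any `a, b`,
`(A^a M A^b)_{ij} = M_{i+a, j−b}` when `i + a < s` and `b ≤ j`, and `0` otherwise. [lead-g2 P-Q1-LEVEL2-PORTMAP (B); folklore] -/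
theorem shift_sandwich_apply (A : Matrix (Fin (s + 1)) (Fin (s + 1)) ℂ)
    (hA : ∀ i j : Fin (s + 1), A i j = if (j : ℕ) = i + 1 ∧ (j : ℕ) < s then 1 else 0) (M : Matrix (Fin (s + 1)) (Fin (s + 1)) ℂ)
    (a b : ℕ) (i j : Fin (s + 1)) (hi : (i : ℕ) < s) (hj : (j : ℕ) < s) :
    (A ^ a * M * A ^ b) i j =
      if h : (i : ℕ) + a < s ∧ b ≤ (j : ℕ) then M ⟨(i : ℕ) + a, by omega⟩ ⟨(j : ℕ) - b, by omega⟩ else 0 := by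
  rw [mul_shift_pow_apply A hA _ b i j hj]
  by_cases hb : b ≤ (j : ℕ)
  · rw [dif_pos hb, shift_pow_mul_apply A hA M a i _ hi]
    by_cases ha : (i : ℕ) + a < s
    · rw [dif_pos ha, dif_pos ⟨ha, hb⟩]
    · rw [dif_neg ha, dif_neg (fun h => ha h.1)]
  · rw [dif_neg hb, dif_neg (fun h => hb h.2)]

/-! ## §2 Traces against rank-one matrices and matrix units -/

/-- `tr(x yᵀ · N) = yᵀ N x`. [folklore] -/
theorem trace_vecMulVec_mul {n : Type*} [Fintype n] [DecidableEq n] (x y : n → ℂ) (N : Matrix n n ℂ) :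
    Matrix.trace (vecMulVec x y * N) = y ⬝ᵥ (N *ᵥ x) := by
  simp only [Matrix.trace, Matrix.diag, Matrix.mul_apply, vecMulVec_apply, dotProduct, Matrix.mulVec]
  rw [Finset.sum_comm]
  refine Finset.sum_congr rfl fun k _ => ?_
  rw [Finset.mul_sum]
  refine Finset.sum_congr rfl fun i _ => ?_
  ring

/-- **Trace against a matrix unit**: `tr(E_{pq} N) = N_{qp}` with `E_{pq} = e_p e_qᵀ = vecMulVec (Pi.single p 1) (Pi.single q 1)`.
[lead-g2 P-Q1-LEVEL2-PORTMAP (B) «tr(E_{pq} N) = N q p»] -/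
theorem trace_single_mul {n : Type*} [Fintype n] [DecidableEq n] (p q : n) (N : Matrix n n ℂ) :
    Matrix.trace (vecMulVec (Pi.single p (1 : ℂ)) (Pi.single q (1 : ℂ)) * N) = N q p := by
  rw [trace_vecMulVec_mul]
  simp [dotProduct, Matrix.mulVec, Pi.single_apply]

/-! ## §3 The envelope `T` of Q1-PROOF §0, read off from the first-order identity at the shift -/

/-- **One sandwich term of the first-order sum**, block entries: `(A^i B A^{s−1−i})_{p r} = B_{p+i, r−(s−1−i)}` when `p + i < s` and `s−1−i ≤ r`,
else `0` (`p, r < s`). [this file] -/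
theorem firstOrder_term_apply (A : Matrix (Fin (s + 1)) (Fin (s + 1)) ℂ)
    (hA : ∀ i j : Fin (s + 1), A i j = if (j : ℕ) = i + 1 ∧ (j : ℕ) < s then 1 else 0) (B : Matrix (Fin (s + 1)) (Fin (s + 1)) ℂ)
    (i : ℕ) (p r : Fin (s + 1)) (hp : (p : ℕ) < s) (hr : (r : ℕ) < s) :
    (A ^ i * B * A ^ (s - 1 - i)) p r =
      if h : (p : ℕ) + i < s ∧ s - 1 - i ≤ (r : ℕ) then B ⟨(p : ℕ) + i, by omega⟩ ⟨(r : ℕ) - (s - 1 - i), by omega⟩ else 0 :=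
  shift_sandwich_apply A hA B i (s - 1 - i) p r hp hr

/-- ★ **Border row of `T`**: if `Σ_{i<s} A^i B A^{s−1−i} = 0` then `B_{ω,0} = 0` (entry `(ω, s−1)` of the sum is the single term `(B A^{s−1})_{ω,s−1} = B_{ω,0}`).
Q1-PROOF §0: «`L(B)_{s,s−1} = B_{s,1}`». [this file] -/
theorem apply_last_zero_eq_zero_of_firstOrder (hs : 1 ≤ s) (A : Matrix (Fin (s + 1)) (Fin (s + 1)) ℂ)
    (hA : ∀ i j : Fin (s + 1), A i j = if (j : ℕ) = i + 1 ∧ (j : ℕ) < s then 1 else 0) (B : Matrix (Fin (s + 1)) (Fin (s + 1)) ℂ)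
    (hL : ∑ i ∈ Finset.range s, A ^ i * B * A ^ (s - 1 - i) = 0) : B (Fin.last s) 0 = 0 := by
  have h := congrFun (congrFun hL (Fin.last s)) ⟨s - 1, by omega⟩
  rw [Matrix.zero_apply, Matrix.sum_apply, Finset.sum_eq_single 0] at h
  · rw [pow_zero, Matrix.one_mul, Nat.sub_zero, mul_shift_pow_apply A hA B (s - 1) _ _ (by simp only; omega), dif_pos (by simp)] at h
    have e : (⟨((⟨s - 1, by omega⟩ : Fin (s + 1)) : ℕ) - (s - 1), by simp⟩ : Fin (s + 1)) = 0 := Fin.ext (by simp)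
    rwa [e] at h
  · intro i hi hi0
    obtain ⟨i', rfl⟩ : ∃ i', i = i' + 1 := ⟨i - 1, by omega⟩
    rw [Matrix.mul_assoc, shift_pow_succ_mul_apply_last A hA]
  · intro h'
    exact absurd (Finset.mem_range.2 (by omega)) h'

/-- ★ **Border column of `T`**: if `Σ_{i<s} A^i B A^{s−1−i} = 0` then `B_{s−1,ω} = 0` (entry `(0, ω)` of the sum is the single term
`(A^{s−1} B)_{0,ω} = B_{s−1,ω}`).  Q1-PROOF §0: «`L(B)_{1,s} = B_{s−1,s}`». [this file] -/
theorem apply_pred_last_eq_zero_of_firstOrder (hs : 1 ≤ s) (A : Matrix (Fin (s + 1)) (Fin (s + 1)) ℂ)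
    (hA : ∀ i j : Fin (s + 1), A i j = if (j : ℕ) = i + 1 ∧ (j : ℕ) < s then 1 else 0) (B : Matrix (Fin (s + 1)) (Fin (s + 1)) ℂ)
    (hL : ∑ i ∈ Finset.range s, A ^ i * B * A ^ (s - 1 - i) = 0) : B ⟨s - 1, by omega⟩ (Fin.last s) = 0 := by
  have h := congrFun (congrFun hL 0) (Fin.last s)
  rw [Matrix.zero_apply, Matrix.sum_apply, Finset.sum_eq_single (s - 1)] at h
  · rw [Nat.sub_self, pow_zero, Matrix.mul_one, shift_pow_mul_apply A hA B (s - 1) _ _ (by simp only [Fin.val_zero]; omega),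
      dif_pos (by simp only [Fin.val_zero]; omega)] at h
    have e : (⟨((0 : Fin (s + 1)) : ℕ) + (s - 1), by simp only [Fin.val_zero]; omega⟩ : Fin (s + 1)) = ⟨s - 1, by omega⟩ :=
      Fin.ext (by simp)
    rwa [e] at h
  · intro i hi hi0
    have hi' := Finset.mem_range.1 hi
    obtain ⟨k, hk⟩ : ∃ k, s - 1 - i = k + 1 := ⟨s - 1 - i - 1, by omega⟩
    rw [hk, mul_shift_pow_succ_apply_last A hA]
  · intro h'
    exact absurd (Finset.mem_range.2 (by omega)) h'

/-- ★ **Block part of `T`: the subdiagonal sums vanish.**  If `Σ_{i<s} A^i B A^{s−1−i} = 0` then for every `h < s` the sum of the `h`-th block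
subdiagonal of `B` is zero: `Σ_{c + h < s} B_{c+h, c} = 0` (`h = 0`: the block trace).  Read off at the entry `(0, s−1−h)`, where the `i`-th sandwich
term contributes `B_{i, i−h}` for `h ≤ i < s`.  Q1-PROOF §0: «`L(B)_{p,r} = Σ_a B_{a+h,a}` over the whole `h`-th block subdiagonal». [this file] -/
theorem subdiag_sum_eq_zero_of_firstOrder (A : Matrix (Fin (s + 1)) (Fin (s + 1)) ℂ)
    (hA : ∀ i j : Fin (s + 1), A i j = if (j : ℕ) = i + 1 ∧ (j : ℕ) < s then 1 else 0) (B : Matrix (Fin (s + 1)) (Fin (s + 1)) ℂ)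
    (hL : ∑ i ∈ Finset.range s, A ^ i * B * A ^ (s - 1 - i) = 0) (h : ℕ) (hh : h < s) :
    ∑ c ∈ Finset.range (s - h), (if hc : c + h < s then B ⟨c + h, by omega⟩ ⟨c, by omega⟩ else 0) = 0 := by
  have h0 := congrFun (congrFun hL 0) ⟨s - 1 - h, by omega⟩
  rw [Matrix.zero_apply, Matrix.sum_apply] at h0
  -- each sandwich term at `(0, s−1−h)` as a function of `i : ℕ`
  set g : ℕ → ℂ := fun i => if hi : i < s then (if hc : h ≤ i then B ⟨i, by omega⟩ ⟨i - h, by omega⟩ else 0) else 0 with hg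
  have hterm : ∀ i, i < s → (A ^ i * B * A ^ (s - 1 - i)) 0 ⟨s - 1 - h, by omega⟩ = g i := by
    intro i hi
    rw [firstOrder_term_apply A hA B i 0 _ (by simp only [Fin.val_zero]; omega) (by simp only; omega), hg]
    simp only
    rw [dif_pos hi]
    by_cases hc : h ≤ i
    · rw [dif_pos (by simp only [Fin.val_zero]; omega), dif_pos hc]
      congr 1
      · exact Fin.ext (by simp)
      · exact Fin.ext (by simp only; omega)
    · rw [dif_neg (by simp only [Fin.val_zero]; omega), dif_neg hc]
  rw [Finset.sum_congr rfl fun i hi => hterm i (Finset.mem_range.1 hi), ← Finset.sum_range_add_sum_Ico g (show h ≤ s by omega),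
    Finset.sum_eq_zero fun i hi => (by rw [hg]; simp only; rw [dif_pos (by have := Finset.mem_range.1 hi; omega),
      dif_neg (by have := Finset.mem_range.1 hi; omega)]), zero_add, Finset.sum_Ico_eq_sum_range] at h0
  rw [← h0]
  refine Finset.sum_congr rfl fun c hc => ?_
  have hc' := Finset.mem_range.1 hc
  rw [hg]
  simp only
  rw [dif_pos (by omega), dif_pos (by omega), dif_pos (by omega)]
  congr 1
  · exact Fin.ext (by simp only; omega)
  · exact Fin.ext (by simp only; omega)

/-- **Corner of `T`**: with the trace condition `tr B = 0` (every member of a nilpotent space is trace-free) the block trace `Σ_{c<s} B_{cc} = 0`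
forces `B_{ωω} = 0`.  Q1-PROOF §0: «together with `tr B = 0` (which then forces `B_{ss} = 0`)». [this file] -/
theorem apply_last_last_eq_zero_of_firstOrder (A : Matrix (Fin (s + 1)) (Fin (s + 1)) ℂ)
    (hA : ∀ i j : Fin (s + 1), A i j = if (j : ℕ) = i + 1 ∧ (j : ℕ) < s then 1 else 0) (B : Matrix (Fin (s + 1)) (Fin (s + 1)) ℂ)
    (hL : ∑ i ∈ Finset.range s, A ^ i * B * A ^ (s - 1 - i) = 0) (htr : Matrix.trace B = 0) (hs : 1 ≤ s) :
    B (Fin.last s) (Fin.last s) = 0 := by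
  have hblock := subdiag_sum_eq_zero_of_firstOrder A hA B hL 0 (by omega)
  rw [Nat.sub_zero] at hblock
  rw [Matrix.trace] at htr
  simp only [Matrix.diag_apply] at htr
  rw [Fin.sum_univ_castSucc] at htr
  have e : ∑ i : Fin s, B i.castSucc i.castSucc = ∑ c ∈ Finset.range s, (if hc : c + 0 < s then B ⟨c + 0, by omega⟩ ⟨c, by omega⟩ else 0) := by
    rw [← Fin.sum_univ_eq_sum_range (fun c => if hc : c + 0 < s then B ⟨c + 0, by omega⟩ ⟨c, by omega⟩ else 0)]
    refine Finset.sum_congr rfl fun i _ => ?_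
    rw [dif_pos (by simp)]
    congr 1
  rw [e, hblock, zero_add] at htr
  exact htr

end Summit.ValiantsHypothesis.ValiantsHypothesis.Theorems.GrenetZeon.HeavyTopShiftSandwich
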